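import Summits.Parity.BatemanHorn.Theses.AlmostPrimeZeros
import Summits.Parity.BatemanHorn.Theorems.AlmostPrimeZerosLinearCappedRepulsionTilted

/-!
# Crux `DiscMajorantLog` (stmt-Parity-17114), line `Sketch`: calibration — the cell `k = 1`, `f = X`
on every FIXED disc

Support lemma for the crux `Summit.Parity.BatemanHorn.Theses.AlmostPrimeZeros.DiscMajorantLog`
(line `Sketch`, the `Re z = 0` cut).  The crux asks, for every Bateman–Horn system, the Γ-budget
majorant `‖S_x(z)‖ ≤ A·x·(log x)^{k(Re z − 1)}·exp(C‖z−1‖ log(‖z−1‖+2))` on the GROWING disc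
`‖z − 1‖ ≤ 3 log log x`.  Its only classical cell is `k = 1`, `f` linear.  This file certifies the
part of that cell the tree's Selberg–Delange engine reaches today: for `f = (X)` the bound holds on
every FIXED disc `‖z − 1‖ ≤ R₀` (both half-discs at once, `C = 0`), as a corollary of the landed
one-sided tilted majorant of the sibling crux `LinearCappedRepulsion`
(`JensenStieltjesMajorant.tiltedMajorant`: radius `log log x / C`, budget `e^{A(1+‖z−1‖)^{3/2}}`):
once `log log x ≥ C·R₀` the fixed disc lies inside the engine's disc and the budget is a constant.

What this does NOT give: the growing radius `3 log log x` with the Γ-budget `e^{C r log(r+2)}` — the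
engine's half-plane of holomorphy `σ > 4/5` for the Euler quotient `G(s; z)` forces
`sup ‖G‖ = exp(≍ R^{7/5})` for `‖z‖ ≤ R`, enveloped there as `e^{b(1+R)^{3/2}}`, which exceeds
`e^{C R log R}`; reaching the crux's cell needs the same engine re-run on `σ > 1 − 1/log R`
(where `sup ‖G‖ = e^{O(R log log R)}`) with the keyhole constant `n!·2ⁿ` kept as `e^{O(R log R)}`
and the de-smoothing length `h = x·e^{−(log log x)⁴}` (lead's census, NOTES.md).
-/

noncomputable section

namespace Summit.Parity.BatemanHorn.Cruxes.DiscMajorantLog.Sketch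

open Polynomial
open Summit.Parity.BatemanHorn.Cruxes.LinearCappedRepulsion.JensenStieltjesMajorant (tiltedMajorant)

namespace FixedDiscX

/-- For the system `f = (X)` the crux's exponent `Σ_i Σ_{p^v ∥ f_i(n)} min(v,2)` is the capped
statistic `s(n) = Σ_{p^v ∥ n} min(v,2)` of `n` itself. [folklore] -/
theorem exponent_X (n : ℕ) :
    (∑ i : Fin 1, ((((![X] : Fin 1 → ℤ[X]) i).eval (n : ℤ)).toNat.factorization.sum
      fun _ v => min v 2)) = n.factorization.sum fun _ v => min v 2 := by
  simp [Matrix.cons_val_fin_one, eval_X, Int.toNat_natCast]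

/-- `log log x ≥ y` as soon as `x ≥ ⌈exp (exp y)⌉₊` (`x` a natural number). [folklore] -/
theorem le_loglog_of_ceil_le {y : ℝ} {x : ℕ} (hx : ⌈Real.exp (Real.exp y)⌉₊ ≤ x) :
    y ≤ Real.log (Real.log (x : ℝ)) := by
  have h1 : Real.exp (Real.exp y) ≤ x := (Nat.le_ceil _).trans (by exact_mod_cast hx)
  have hx0 : (0 : ℝ) < x := (Real.exp_pos _).trans_le h1
  have h2 : Real.exp y ≤ Real.log (x : ℝ) := by rwa [Real.le_log_iff_exp_le hx0]
  have hlog0 : 0 < Real.log (x : ℝ) := (Real.exp_pos _).trans_le h2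
  rwa [Real.le_log_iff_exp_le hlog0]

end FixedDiscX

open FixedDiscX in
/-- **Calibration (`k = 1`, `f = X`, fixed disc).**  For every `R₀` there are `A, C` (`C = 0`) and
`x₀` such that for all `x ≥ x₀` and all `z` with `‖z − 1‖ ≤ R₀`:
`‖Σ_{0≤n≤x} z^{s(n)}‖ ≤ A·x·(log x)^{Re z − 1}·exp(C‖z−1‖ log(‖z−1‖+2))` — the body of the crux
`DiscMajorantLog` for the system `(X)` with the growing radius `3 log log x` replaced by the fixed
radius `R₀` (so both `stub_rightHalfDiscMajorantLog` and `stub_leftHalfDiscMajorantLog` hold in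
this cell on fixed discs).  Proof: `tiltedMajorant` on `‖z − 1‖ ≤ log log x / C ⊇ {‖z−1‖ ≤ R₀}` once
`log log x ≥ C R₀`, `exp(log log x·(Re z−1)) = (log x)^{Re z−1}`, `A(1+‖z−1‖)^{3/2} ≤ A(1+R₀)^{3/2}`,
`x + 1 ≤ 2x`. [cite: MontgomeryVaughan2007, §7.4 Theorems 7.17–7.18] -/
theorem stub_fixedDiscX :
    ∀ R₀ : ℝ, ∃ A C : ℝ, ∃ x₀ : ℕ, ∀ x : ℕ, x₀ ≤ x → ∀ z : ℂ, ‖z - 1‖ ≤ R₀ →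
      ‖(∑ n ∈ Finset.range (x + 1), (z : ℂ) ^ (∑ i, ((((![X] : Fin 1 → ℤ[X]) i).eval
          (n : ℤ)).toNat.factorization.sum fun _ v => min v 2)))‖ ≤
        A * (x : ℝ) * (Real.log (x : ℝ)) ^ (((1 : ℕ) : ℝ) * ((z : ℂ).re - 1)) *
          Real.exp (C * ‖(z : ℂ) - 1‖ * Real.log (‖(z : ℂ) - 1‖ + 2)) := by
  intro R₀
  obtain ⟨A, hA0, C, hC, x₀, h⟩ := tiltedMajorant
  refine ⟨2 * Real.exp (A * (1 + R₀) ^ (3 / 2 : ℝ)), 0,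
    max (max x₀ 3) ⌈Real.exp (Real.exp (C * R₀))⌉₊, fun x hx z hz => ?_⟩
  have hx₀ : x₀ ≤ x := (le_max_left _ _).trans ((le_max_left _ _).trans hx)
  have hx3 : (3 : ℝ) ≤ x := by exact_mod_cast (le_max_right x₀ 3).trans ((le_max_left _ _).trans hx)
  have hℓ : C * R₀ ≤ Real.log (Real.log (x : ℝ)) := le_loglog_of_ceil_le ((le_max_right _ _).trans hx)
  have hx0 : (0 : ℝ) < x := by linarith
  have hlog : 0 < Real.log (x : ℝ) := Real.log_pos (by linarith)
  -- the fixed disc lies inside the engine's disc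
  have hzC : ‖z - 1‖ ≤ Real.log (Real.log (x : ℝ)) / C := by
    rw [le_div_iff₀ hC]; nlinarith
  have hmain := h x hx₀ z hzC
  simp_rw [exponent_X]
  -- rewrite the engine's right-hand side into the crux's shape
  have hr0 : 0 ≤ ‖z - 1‖ := norm_nonneg _
  have hpow : Real.exp (Real.log (Real.log (x : ℝ)) * (z.re - 1)) =
      Real.log (x : ℝ) ^ (((1 : ℕ) : ℝ) * (z.re - 1)) := by
    rw [Nat.cast_one, one_mul, Real.rpow_def_of_pos hlog]
  have hbud : Real.exp (A * (1 + ‖z - 1‖) ^ (3 / 2 : ℝ)) ≤ Real.exp (A * (1 + R₀) ^ (3 / 2 : ℝ)) := by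
    apply Real.exp_le_exp.2
    exact mul_le_mul_of_nonneg_left
      (Real.rpow_le_rpow (by linarith) (by linarith) (by norm_num)) hA0
  have hP : 0 ≤ Real.log (x : ℝ) ^ (((1 : ℕ) : ℝ) * (z.re - 1)) := Real.rpow_nonneg hlog.le _
  calc ‖∑ n ∈ Finset.range (x + 1), z ^ (n.factorization.sum fun _ v => min v 2)‖
      ≤ ((x : ℝ) + 1) * Real.exp (Real.log (Real.log (x : ℝ)) * (z.re - 1) +
          A * (1 + ‖z - 1‖) ^ (3 / 2 : ℝ)) := hmain
    _ = ((x : ℝ) + 1) * Real.log (x : ℝ) ^ (((1 : ℕ) : ℝ) * (z.re - 1)) *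
          Real.exp (A * (1 + ‖z - 1‖) ^ (3 / 2 : ℝ)) := by rw [Real.exp_add, hpow]; ring
    _ ≤ (2 * (x : ℝ)) * Real.log (x : ℝ) ^ (((1 : ℕ) : ℝ) * (z.re - 1)) *
          Real.exp (A * (1 + R₀) ^ (3 / 2 : ℝ)) := by
        apply mul_le_mul _ hbud (Real.exp_pos _).le (by positivity)
        exact mul_le_mul_of_nonneg_right (by linarith) hP
    _ = 2 * Real.exp (A * (1 + R₀) ^ (3 / 2 : ℝ)) * (x : ℝ) *
          Real.log (x : ℝ) ^ (((1 : ℕ) : ℝ) * (z.re - 1)) *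
          Real.exp (0 * ‖z - 1‖ * Real.log (‖z - 1‖ + 2)) := by
        rw [zero_mul, zero_mul, Real.exp_zero]; ring

/-- Curried form of `stub_fixedDiscX`: the `k = 1`, `f = X` cell of `DiscMajorantLog` on the fixed
disc `‖z − 1‖ ≤ R₀`. [cite: MontgomeryVaughan2007, §7.4 Theorems 7.17–7.18] -/
theorem discMajorantLog_fixedDisc_X (R₀ : ℝ) :
    ∃ A C : ℝ, ∃ x₀ : ℕ, ∀ x : ℕ, x₀ ≤ x → ∀ z : ℂ, ‖z - 1‖ ≤ R₀ →
      ‖(∑ n ∈ Finset.range (x + 1), (z : ℂ) ^ (∑ i, ((((![X] : Fin 1 → ℤ[X]) i).eval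
          (n : ℤ)).toNat.factorization.sum fun _ v => min v 2)))‖ ≤
        A * (x : ℝ) * (Real.log (x : ℝ)) ^ (((1 : ℕ) : ℝ) * ((z : ℂ).re - 1)) *
          Real.exp (C * ‖(z : ℂ) - 1‖ * Real.log (‖(z : ℂ) - 1‖ + 2)) :=
  stub_fixedDiscX R₀

end Summit.Parity.BatemanHorn.Cruxes.DiscMajorantLog.Sketch

end
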